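import Literature.AlgebraicGeometry.Resolution.MarkedIdeals
import Literature.AlgebraicGeometry.Resolution.ChowLemmaProofs
import Literature.AlgebraicGeometry.Motives.Varieties
import Mathlib.AlgebraicGeometry.Morphisms.Immersion
import Mathlib.FieldTheory.IsAlgClosed.Basic
import HarnessLib

/-!
# Order reduction for an ideal of maximal order `r` on a nonsingular quasi-projective threefold over an algebraically closed field of arbitrary characteristic, with snc boundary (Cutkosky 2009, Thm. 5.6)

Topic: `Literature/AlgebraicGeometry/Resolution`. ONE NAMED FACT, statement only (no proof is
attempted here), vendored from the refereed paper

* S. D. Cutkosky, *Resolution of singularities for 3-folds in positive characteristic*,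
  Amer. J. Math. **131** (2009) 59–127 [Cutkosky2009]; read in the held author version
  (`paper:doi-10-1353-ajm-0-0036`, 55 pp.; below "pNN Lmm" = page NN, text line mm of that
  version; statement numbers are the paper's),

namely its **Theorem 5.6** (p19 L13–16), the "main resolution theorem for ideals on a nonsingular
3-fold" (p19 L11–12) from which the paper derives embedded resolution of surfaces (Thm. 1.2) and
principalization of ideals (Thm. 1.3) on nonsingular threefolds over algebraically closed fields of
ANY characteristic (§11). The abstract proof skeleton of §§5–11 typed earlier
(`Literature.AlgebraicGeometry.Cutkosky2009.DatumReduction`, signature `Sig56`, `thm56_of_nodes`)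
is a bookkeeping object over an abstract type of data; the present file states the theorem ON
SCHEMES, in the vocabulary the tree already uses for Kollár's characteristic-zero twin
`Kollar2007MarkedOrderReduction` (`KollarOrderReduction.lean`) and for Bierstone–Grigoriev–Milman–
Włodarczyk's marked ideals (`MarkedIdeals.lean`): `MarkedIdeal`, `idealOrder`, `HasSNC`,
`IsMarkedResolution`. Nothing is redefined.

## The printed statement and its notions (all defined inside the paper)

* "In this paper, a variety is an open subset of an integral, closed subscheme of `ℙⁿ`. A curve,
  surface or 3-fold is a variety of the corresponding dimension." (p16 L12–14) — rendered: an
  integral `k`-scheme `V` with an immersion `ι : V ⟶ ℙⁿ_k` over `k` (the idiom of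
  `Kollar2007QuasiProjectiveResolution`, `Motives.projectiveSpace`) and `topologicalKrullDim V = 3`;
  "nonsingular … over an algebraically closed field `k`" — all local rings regular
  (`Scheme.IsRegular`; over a perfect field regular = smooth for schemes locally of finite type).
* "`ν_R(I)` is defined to be the largest integer `n` such that `I ⊂ M(R)ⁿ` … `ν_q(J) = ν_{𝒪_{W,q}}(J_q)`"
  (p14 L45–47) = `idealOrder`; "`Sing_t(R) = Sing_t(I) = {p ∈ V | ν_p(I) ≥ t}`",
  "`r = ν(R) = ν(I) = max{ν_p(I) | p ∈ V}`" (p18 L37–40; `q` "a (not necessarily closed) point",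
  p17 L9–10) = `MarkedIdeal.support ⟨I, E, t⟩` and the hypothesis `∀ x, idealOrder I x ≤ r`.
* "An effective divisor `D` on `X` is a simple normal crossings divisor on `X` if for each `p ∈ X`
  there exist regular parameters `x_1, …, x_n` in `𝒪_{X,p}` and `a_1, …, a_n ∈ ℕ` such that `D` is
  the divisor `x_1^{a_1} ⋯ x_n^{a_n} = 0` in a neighborhood of `p`"; "`Y` is transversal to `D` if
  `Y` is nonsingular, and for `p ∈ Y ∩ D` there exist regular parameters … such that `D` is the
  divisor `x_1^{a_1} ⋯ x_n^{a_n} = 0` … and `V(x_1, …, x_r) ⊂ Spec(𝒪_{X,p})` is the germ of `Y`"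
  (p16 L44–51) = `HasSNC E` / `HasSNCWith E C` of `MarkedIdeals.lean` (the same regular-system-of-
  parameters condition in the Zariski local rings), `E` being recorded, as everywhere in this topic,
  by the LIST of the ideal sheaves of its (smooth) components; the multiplicities `a_i` of the
  printed effective divisor play no role in Def. 5.5 or in the conclusion and are not recorded.
* **Definition 5.4** (p18 L32–35): "A resolution datum `R = (E⁺, E⁻, I, V)` is a 4-tuple where
  `E⁺` and `E⁻` are effective divisors on a nonsingular variety `V` over an algebraically closed
  field `k`, such that `E = E⁺ + E⁻` is a SNC divisor, `E⁺` and `E⁻` have no common components, and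
  `I` is an ideal sheaf on `V`." (`I` nonzero: p17 L9.) Theorem 5.6 is stated for `E⁺ = ∅`.
* **Definition 5.5** (p18 L47–48): "A permissible transform of `R` is the blow up `π_1 : V_1 → V`
  of a nonsingular subvariety `Y ⊂ Sing_r(R)` such that `Y` is transversal to `E = E⁺ + E⁻`."
  Transform (p19 L5–9): "`R_1 = (E_1⁺, E_1⁻, I_1, V_1)` where `I_1` is the weak transform of `I`
  [`I𝒪_{V_1} = 𝒪_{V_1}(−tF)·I_1`, `t = ν_q(I_q)` at the generic point `q` of `Y`, p17 L17–20], and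
  `E_1⁺ = π_1^*(E⁺) + F`, `E_1⁻ =` the strict transform of `E⁻` if `ν(I_1) = ν(R)`; `E_1⁺ = ∅`,
  `E_1⁻ = π_1^*(E⁺ + E⁻) + F` if `ν(I_1) < ν(R)`" — in either case `Supp E_1 =` (strict transforms
  of the components of `E`) `∪ F`, which is `MarkedIdeal.transform`'s boundary; and since
  `Y ⊆ Sing_r(I)` with `r` the MAXIMAL order, `t = r` (order is upper semicontinuous), so the weak
  transform is the controlled transform `𝒪(−rF)⁻¹·π^*I` of the marked ideal `(I, E, r)`
  (`MarkedIdeal.transform`; Kollár 2007, Rem. 3.67, p. 149 L38–40 makes the same identification). Hence "a sequence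
  of permissible transforms of `R = (∅, E, I, V)` ending with `Sing_r(R_1) = ∅`" is exactly
  `IsMarkedResolution ⟨I, E, r⟩ π R'` (centres regular = nonsingular over `k = k̄`, inside
  `Sing_r(I_i) = supp(I_i, E_i, r)`, snc with `E_i`, transforms as above, final support empty).
* **Theorem 5.6** (p19 L13–16, VERBATIM): "Suppose that `V` is a nonsingular 3-fold over an
  algebraically closed field `k`, and `R = (∅, E, I, V)` is a resolution datum. Let `r = ν(R) ≥ 1`.
  Then there exists a sequence of permissible transforms `π : V_1 → V` of `R` such that
  `Sing_r(R_1) = ∅`, where `R_1` is the transform of `R` by `π`."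

## Content

* `Cutkosky2009_thm_5_6` — the NAMED FACT (statement only; users take `(h : Cutkosky2009_thm_5_6)`).
* `Cutkosky2009_thm_5_6.support_eq_empty_of_forall_lt`, `.conclusion_of_forall_lt`,
  `.conclusion_top` — PROVED: the case `r > ν(R)` / the unit ideal is resolved by the identity
  (equivalence of the vendored `r`-binder with the printed `r = ν(R)`; non-vacuity of the
  conclusion shape).
* `Cutkosky2009_thm_5_6.of_isAffine` — PROVED corollary: the fact on AFFINE integral `k`-schemes
  of finite type (affine of finite type ⇒ quasi-projective,
  `ChowLemmaProof.exists_immersion_projectiveSpace`), the form consumed chart by chart.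

## Faithfulness notes

* `r` enters as "`1 ≤ r` and `ν_x(I) ≤ r` for all `x`": for `r = ν(R)` this is the printed
  hypothesis; for `r > ν(R)` the support `Sing_r(I)` is empty and the identity is a marked
  resolution (`Cutkosky2009_thm_5_6.conclusion_of_forall_lt`, proved below), so the vendored
  sentence is EQUIVALENT to the printed one, not stronger.
* The split `E = E⁺ + E⁻` and the invariant `η` (p18 L41–44) steer the paper's ALGORITHM
  (Thm. 7.2, §8) but do not occur in the statement of Thm. 5.6 beyond `E⁺ = ∅`; they are not
  recorded. No functoriality, no canonicity and no bound is asserted — existence only, as printed.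
* The book [C2] (Cutkosky, *Resolution of Singularities*, GSM 63, 2004) is cited by the paper for
  PROOFS (Lemma 5.1: "as in Lemma 6.4 and Lemma 7.5 [C2]", p17 L54; §§6–8) and as a cross-reference
  for standard notions ("cf page 65 [C2]" for the weak transform, whose defining equation is
  printed in the paper, p17 L19–20); no notion of the STATEMENT depends on it.
* Relation to tree statements: characteristic-free, dimension `3`, `k = k̄`, marking `m = max-ord`,
  WITH boundary — versus `Kollar2007MarkedOrderReduction` (char. `0`, any dimension, any `m ≥ 1`,
  empty boundary) and `CossartPiltant2019Principalization` (principalization, excellent regular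
  threefolds, no boundary, no order control). AI transcription; AI review is weaker than expert
  review. Users take `(h : Cutkosky2009_thm_5_6)`.
-/

noncomputable section

open CategoryTheory AlgebraicGeometry TopologicalSpace

namespace Literature.AlgebraicGeometry.Resolution

universe u

/-- NAMED FACT — **Cutkosky 2009, Theorem 5.6 (order reduction for ideals on nonsingular
threefolds over algebraically closed fields of arbitrary characteristic, with snc boundary).**
Printed (p19 L13–16): "Suppose that `V` is a nonsingular 3-fold over an algebraically closed field
`k`, and `R = (∅, E, I, V)` is a resolution datum. Let `r = ν(R) ≥ 1`. Then there exists a sequence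
of permissible transforms `π : V_1 → V` of `R` such that `Sing_r(R_1) = ∅`, where `R_1` is the
transform of `R` by `π`." With Def. 5.4 (p18 L32–35: `E` a SNC divisor on `V`, `I` a [nonzero,
p17 L9] ideal sheaf), Def. 5.5 (p18 L47–48: blow up nonsingular `Y ⊂ Sing_r(R)` transversal to
`E`), the transform rule (p19 L5–9; weak transform p17 L17–20), "variety" = open subset of an
integral closed subscheme of `ℙⁿ` (p16 L12–14) and `ν` = `idealOrder` (p14 L45–47), rendered over
`MarkedIdeals.lean` exactly as Kollár's characteristic-zero twin `Kollar2007MarkedOrderReduction`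
(see the module docstring for the line-by-line dictionary): for every algebraically closed field
`k` (any characteristic), every integral `k`-scheme `V` immersed in some `ℙⁿ_k` with all local
rings regular and `dim V = 3`, every snc boundary `E`, every ideal sheaf `I ≠ 0` and every `r ≥ 1`
with `ν_x(I) ≤ r` for all `x ∈ V`, the marked ideal `(I, E, r)` admits a marked resolution: a
finite sequence of blow-ups in regular centres contained in `Sing_r` of the successive weak
(= controlled) transforms and having snc with the successive boundaries, after which no point of
order `≥ r` remains. Users take `(h : Cutkosky2009_thm_5_6)`.
[cite: Cutkosky2009, Thm. 5.6 (author version p. 19) with Defs. 5.4, 5.5 (p. 18)] -/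
def Cutkosky2009_thm_5_6 : Prop :=
  ∀ (k : Type u) [Field k] [IsAlgClosed k] (n : ℕ) (V : Scheme.{u})
    (ι : V ⟶ (Motives.projectiveSpace n k).left), IsImmersion ι → IsIntegral V →
    Scheme.IsRegular V → topologicalKrullDim V = 3 →
    ∀ (E : List V.IdealSheafData), HasSNC E →
    ∀ (I : V.IdealSheafData), I ≠ ⊥ → ∀ (r : ℕ), 1 ≤ r → (∀ x : V, idealOrder I x ≤ r) →
      ∃ (V' : Scheme.{u}) (π : V' ⟶ V) (R' : MarkedIdeal V'),
        IsMarkedResolution (⟨I, E, r⟩ : MarkedIdeal V) π R'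

namespace Cutkosky2009_thm_5_6

variable {V : Scheme.{u}}

/-- If every point has order `< r` then `Sing_r(I) = supp(I, E, r)` is empty ("the case
`max-ord I < m` is trivial"). [cite: Kollar2007, remark after Thm. 3.69 (p. 150)] -/
theorem support_eq_empty_of_forall_lt (I : V.IdealSheafData) (E : List V.IdealSheafData) {r : ℕ}
    (h : ∀ x : V, idealOrder I x < r) : (⟨I, E, r⟩ : MarkedIdeal V).support = ∅ :=
  Set.eq_empty_of_forall_notMem fun x hx => (not_le.mpr (h x)) hx

/-- **The case `r > ν(R)` of the vendored sentence is trivial** (so the fact is equivalent to the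
printed one with `r = ν(R)`): if `ν_x(I) < r` everywhere, the identity of `V` is a marked
resolution of `(I, E, r)` — Kollár's remark "the case `max-ord I < m` is trivial, that is,
`X_r = X`". [cite: Kollar2007, remark after Thm. 3.69 (p. 150)] -/
theorem conclusion_of_forall_lt (I : V.IdealSheafData) (E : List V.IdealSheafData) {r : ℕ}
    (h : ∀ x : V, idealOrder I x < r) :
    ∃ (V' : Scheme.{u}) (π : V' ⟶ V) (R' : MarkedIdeal V'),
      IsMarkedResolution (⟨I, E, r⟩ : MarkedIdeal V) π R' :=
  ⟨V, 𝟙 V, ⟨I, E, r⟩, isMarkedResolution_refl (support_eq_empty_of_forall_lt I E h)⟩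

/-- Non-vacuity of the conclusion shape: for the unit ideal (order `0` everywhere) and any
boundary `E`, any `r ≥ 1`, the identity is a marked resolution ("the case `max-ord I < m` is
trivial, that is, `X_r = X`"). [cite: Kollar2007, remark after Thm. 3.69 (p. 150)] -/
theorem conclusion_top (E : List V.IdealSheafData) {r : ℕ} (hr : 1 ≤ r) :
    ∃ (V' : Scheme.{u}) (π : V' ⟶ V) (R' : MarkedIdeal V'),
      IsMarkedResolution (⟨⊤, E, r⟩ : MarkedIdeal V) π R' :=
  conclusion_of_forall_lt ⊤ E fun x => by
    rw [idealOrder_top]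
    exact_mod_cast hr

/-- **Affine charts.** The fact applies to every AFFINE integral `k`-scheme of finite type with
regular local rings and `dim = 3` (an affine scheme of finite type over `k` is quasi-projective:
`ChowLemmaProof.exists_immersion_projectiveSpace`, Görtz–Wedhorn §(12.15)) — the form in which a
local argument on an affine neighbourhood consumes it.
[cite: Cutkosky2009, Thm. 5.6 (author version p. 19)] -/
theorem of_isAffine (h : Cutkosky2009_thm_5_6.{u}) (k : Type u) [Field k] [IsAlgClosed k]
    (V : Scheme.{u}) [IsAffine V] (g : V ⟶ Spec (.of k)) [LocallyOfFiniteType g]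
    (hint : IsIntegral V) (hreg : Scheme.IsRegular V) (hdim : topologicalKrullDim V = 3)
    (E : List V.IdealSheafData) (hE : HasSNC E) (I : V.IdealSheafData) (hI : I ≠ ⊥)
    (r : ℕ) (hr : 1 ≤ r) (hord : ∀ x : V, idealOrder I x ≤ r) :
    ∃ (V' : Scheme.{u}) (π : V' ⟶ V) (R' : MarkedIdeal V'),
      IsMarkedResolution (⟨I, E, r⟩ : MarkedIdeal V) π R' := by
  obtain ⟨n, ρ, hρ, -⟩ := ChowLemmaProof.exists_immersion_projectiveSpace k g
  exact h k n V ρ hρ hint hreg hdim E hE I hI r hr hord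

end Cutkosky2009_thm_5_6

end Literature.AlgebraicGeometry.Resolution

end
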